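import Summits.BirchSwinnertonDyer.BirchSwinnertonDyer.Theorems.GenusKolyvaginAtTwoGenusPrimitiveSupplyAtTwoTwistingPrimeInvolution
import Summits.BirchSwinnertonDyer.BirchSwinnertonDyer.Theorems.GenusKolyvaginAtTwoGenusPrimitiveSupplyAtTwoTwoTranspositionIff
import Summits.BirchSwinnertonDyer.BirchSwinnertonDyer.Theorems.GenusKolyvaginAtTwoGenusPrimitiveSupplyAtTwoTranspositionSupply
import Summits.BirchSwinnertonDyer.BirchSwinnertonDyer.Theorems.GenusKolyvaginAtTwoGenusPrimitiveSupplyAtTwoArchimedeanRelaxedSwitchEgg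
import Summits.BirchSwinnertonDyer.BirchSwinnertonDyer.Theorems.GenusKolyvaginAtTwoGenusPrimitiveSupplyAtTwoConjugationTypeAtTwo
import Summits.BirchSwinnertonDyer.Rank1Residual.F1Sign2.TwoTranspositionDoorAtTwo
import Literature.NumberTheory.QuadraticFields.KroneckerSplitting
import Literature.NumberTheory.EllipticCurves.StrictSelmerTorsionLevelUniformBound
import HarnessLib

/-!
# Route `GenusKolyvaginAtTwo`, crux #2 `GenusPrimitiveSupplyAtTwo` (stmt-BirchSwinnertonDyer-22136):
# AN-26S — `F1Sign2.TwoDoor.TwoTranspositionSupplyAtTwo` HOLDS: at `Δ > 0`, `ε = −1` an imaginary quadratic Heegner field with TWO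
# transposition primes and a `Sel₂`-TRIVIAL twist exists (Mazur–Rubin twisting primes, twice)

Width seat `bsd-line-gk2-p4` g15 (cell `bsd-f1-sign2`), sequel of `…TwistingPrimeInvolution` (twisting primes with a prescribed involution),
`…TwoTranspositionIff` (the quadratic `iff` of T-2q, p669774) and `…TranspositionSupply` (AN-24S, the `Δ < 0` single door, g13). THEOREMS ONLY
(no definition, no named fact, no `sorry`); helper `--supports stmt-BirchSwinnertonDyer-22136`; no item is closed; BSD is not proved by any of this.

WHAT.
* §39 `localization_ne_zero_of_not_mem_torsionLocalKer_padic` (bridge `ℚ_v ≅ ℚ_ℓ` for the strict local condition), `jacobiSym_eq_neg_one_of_frob_smul_eq`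
  (a Frobenius acting on `E[2]` as an ODD permutation makes `(Δ_min/q) = −1`, via fkl-p2's `sign_permGal_eq_legendreSym_of_isArithFrobAt`), and
  **`twoTranspositionSupplyAtTwo_holds : TwoTranspositionSupplyAtTwo`** — the cell's AN-26S (REF1 §69 repaired form C′, `¬ IsSquare Δ`) BY NAME.
  Construction: `g₀ ∈ Γ_ℚ` odd on `{T₀, T₁, T₂}` (`Δ ∉ ℚ²`, Dokchitser–Dokchitser); `R = Sel^{rel ∞}_2(W) = {0, x, y, x + y}`, `x = κ(P₀)` (rank one,
  `#R = 4` at `ε = −1`, gk2-p5); `q₀ > 8N` twisting for `x` with Frobenius `≡ g₀` (door OPEN at `q₀`, `(Δ/q₀) = −1`); `q₁ > q₀` twisting for `y`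
  (if `loc_{q₀} y = 0`) else for `x + y`, with Frobenius `≡ c₀F₀` (`c₀` fixes `E[2]` at `Δ > 0` and inverts `μ_{8N}`, so `8N ∣ q₀ + q₁`); then
  `d = −q₀q₁ ≡ q₀² (mod 8N)` is `≡ 1 (8)`, a square mod every `ℓ ∣ N` (Heegner hypothesis, `2` split, `(d, N) = 1`), squarefree with exactly the
  two good transposition primes, and no non-zero class of `R` dies at both `q₀` and `q₁`, so `Sel₂(W^{(d)}) = 0` by the quadratic `iff` of T-2q.

Honest framing: KNOWN in print (Mazur–Rubin 2010 Lemma 3.5 / Prop. 3.3 method + Čebotarev; Klagsbrun–Mazur–Rubin 2014 Prop. 47 (ii)); kernel-new;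
beyond-print theorem: no. With T-2q (`twoTranspositionTwistLawAtTwo_holds`) and this file, the `ε = −1` door's THEOREM-grade rows are both tree
theorems; AN-26 `TwoTranspositionIndexLawAtTwo` and the value law remain `@[conjecture]`. Crux 22136 stays OPEN at (U) 24947 ∧ (CONV₂) 19220/24948.

References: [MazurRubin2010] Lemma 3.2, Lemma 3.5, Prop. 3.3; [KlagsbrunMazurRubin2014] Prop. 47 (ii); [GrossLMS1991] §1 (p. 235), §9;
[DokchitserDokchitserMathZ2012] Theorem (1); [Kramer1981] Prop. 3.
-/

set_option linter.dupNamespace false -- tree convention: `Summit.BirchSwinnertonDyer.BirchSwinnertonDyer.Theorems` (summit = sub-problem)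
set_option autoImplicit false

noncomputable section

open scoped Classical Pointwise

/-! ## §39 AN-26S: the two-transposition supply at `Δ > 0`, `ε = −1` -/

namespace Summit.BirchSwinnertonDyer.BirchSwinnertonDyer.Theorems.GenusKolyTransp

open WeierstrassCurve Field NumberField IsDedekindDomain Function
open Literature.NumberTheory.EllipticCurves Literature.NumberTheory.GaloisRepresentations
open Literature.NumberTheory.GaloisCohomology Literature.NumberTheory
open Literature.NumberTheory.EllipticCurves.DokchitserDokchitser2012 (T T_injective T_permGal eq_zero_or_eq_T permGal permGal_mul
  delta smul_delta isSquare_Δ_iff_forall_smul_delta)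
open Literature.NumberTheory.QuadraticFields (Quadratic.exists_numberField_discr_eq Quadratic.isTotallyComplex_of_discr_neg
  Quadratic.ncard_primesOver_eq_two_iff_jacobiSym Quadratic.ncard_primesOver_two_eq_two_iff)
open Rat.HeightOneSpectrum (primesEquiv natGenerator)
open Summit.BirchSwinnertonDyer.Rank1Residual.F1Sign2
open Summit.BirchSwinnertonDyer.Rank1Residual.F1Sign2.EggDoubling (eq_zero_of_two_smul_eq_zero)
open Summit.BirchSwinnertonDyer.Rank1Residual.F1Sign2.TranspositionDoor (MeetsNonNormAt)
open Summit.BirchSwinnertonDyer.Rank1Residual.F1Sign2.TwoDoor (TwoTranspAdmissible TwoTranspositionSupplyAtTwo)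
open Summit.BirchSwinnertonDyer.BirchSwinnertonDyer.Theorems.GenusKolyArch (hdiv_two natCard_selmerGroupRelaxedAtInfinityAtTwo_eq_four_of_not_meetsEgg)
open Summit.BirchSwinnertonDyer.BirchSwinnertonDyer.Theorems.GenusKolyTwistingPrime (primesEquiv_eq exists_twistingPrime_of_involution)
open Summit.BirchSwinnertonDyer.BirchSwinnertonDyer.Theorems.GenusKolyTwistLocal (mem_torsionLocalKer_iff_localization_eq_zero_rat)
open Summit.BirchSwinnertonDyer.BirchSwinnertonDyer.Theorems.RankOneAtTwoOneDoor (sign_permGal_eq_legendreSym_of_isArithFrobAt)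

/-- **`loc_v c ≠ 0` from the twisting-prime output `c ∉ ker (H¹(ℚ, E[2]) → H¹(ℚ_ℓ, E[2]))`** (`ℚ_v ≅ ℚ_ℓ`, Mathlib `padicEquiv`; the bridge
of g13's `transpositionSupplyAtTwo_holds`, isolated). [folklore] -/
theorem localization_ne_zero_of_not_mem_torsionLocalKer_padic (W : WeierstrassCurve ℚ) [W.IsElliptic] {ℓ : ℕ} [Fact ℓ.Prime]
    {v : HeightOneSpectrum (𝓞 ℚ)} (hv : (ℓ : 𝓞 ℚ) ∈ v.asIdeal) {c : W.galH1Torsion ((2 : ℕ) : ℤ)}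
    (hc : c ∉ W.torsionLocalKer ℚ_[ℓ] ((2 : ℕ) : ℤ)) :
    galoisCohomology.localization (W.torsionGaloisModule ((2 : ℕ) : ℤ)) (Sum.inr v) 1 c ≠ 0 := by
  intro h0
  apply hc
  have h1 := (mem_torsionLocalKer_iff_localization_eq_zero_rat W v c).mpr h0
  have hℓ : ℓ.Prime := Fact.out
  obtain hpq := primesEquiv_eq hℓ hv
  subst hpq
  letI : Algebra ℚ (v.adicCompletion ℚ) := inferInstance
  haveI : CharZero (v.adicCompletion ℚ) := charZero_adicCompletion v
  exact (GenusKolyTwistingPrime.mem_torsionLocalKer_padic_iff W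
    (RingEquivClass.toRingEquiv (Rat.HeightOneSpectrum.adicCompletion.padicEquiv (R := 𝓞 ℚ) v)) ((2 : ℕ) : ℤ) _).mpr h1

/-- **An arithmetic Frobenius acting on `E[2]` as an ODD permutation of `{T₀, T₁, T₂}` makes its prime a TRANSPOSITION prime: `(Δ_min/q) = −1`**
(`W/ℚ` globally minimal, `q` odd good, `F` Frobenius at a prime above `q` agreeing on `E[2]` with some `g` of sign `−1`): the sign of the permutation
is `F`'s action on `√Δ`, i.e. the Legendre symbol (`sign_permGal_eq_legendreSym_of_isArithFrobAt`, fkl-p2). [cite: DokchitserDokchitserMathZ2012, Theorem (1), proof]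
[cite: IrelandRosen1990, Prop. 5.1.2 and 13.1.3] -/
theorem jacobiSym_eq_neg_one_of_frob_smul_eq (W : WeierstrassCurve ℚ) [W.IsElliptic] [W.IsGloballyMinimal] {q : ℕ} [Fact q.Prime]
    (hq2 : q ≠ 2) (hgood : W.HasGoodReductionAtPrime q) {v : HeightOneSpectrum (𝓞 ℚ)} (hv : (q : 𝓞 ℚ) ∈ v.asIdeal)
    {𝔓 : Ideal (absIntegers (𝓞 ℚ) ℚ)} (h𝔓 : 𝔓 ∈ v.primesAbove) {F g : absoluteGaloisGroup ℚ} (hF : IsArithFrobAt (𝓞 ℚ) F 𝔓)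
    (hFg : ∀ P : geomTorsion W (2 : ℤ), F • P = g • P)
    (hg : Equiv.Perm.sign (permGal W (two_ne_zero : (2 : ℚ) ≠ 0) g) = -1) :
    jacobiSym W.Δ.num q = -1 := by
  have hqΔmin : ¬ (q : ℤ) ∣ minimalDiscriminantInt W := W.not_dvd_minimalDiscriminantInt_of_hasGoodReductionAtPrime' _ hgood
  have hqΔ : ¬ (q : ℤ) ∣ W.Δ.num := by rwa [← cast_minimalDiscriminantInt W, Rat.num_intCast]
  have hΔ : W.Δ = (W.Δ.num : ℚ) := by
    have hnum : W.Δ.num = minimalDiscriminantInt W := by rw [← cast_minimalDiscriminantInt W, Rat.num_intCast]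
    rw [hnum, cast_minimalDiscriminantInt]
  have hperm : permGal W (two_ne_zero : (2 : ℚ) ≠ 0) F = permGal W two_ne_zero g :=
    Equiv.ext fun i ↦ T_injective W _ (by rw [T_permGal, T_permGal, hFg])
  have hsignQ := sign_permGal_eq_legendreSym_of_isArithFrobAt W hΔ hq2 hqΔ hv h𝔓 hF
  rw [hperm, hg] at hsignQ
  rw [← jacobiSym.legendreSym.to_jacobiSym]
  have h : ((legendreSym q W.Δ.num : ℤ) : ℚ) = -1 := by rw [← hsignQ]; norm_num
  exact_mod_cast h

/-- `q² ≡ 1 (mod 8)` for odd `q`. [folklore] -/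
private theorem sq_emod_eight_of_odd {q : ℤ} (hq : Odd q) : q ^ 2 % 8 = 1 := by
  have h : q % 8 = 1 ∨ q % 8 = 3 ∨ q % 8 = 5 ∨ q % 8 = 7 := by
    obtain ⟨k, rfl⟩ := hq; omega
  rw [sq, Int.mul_emod]
  rcases h with h | h | h | h <;> rw [h] <;> norm_num

/-- **AN-26S — `F1Sign2.TwoDoor.TwoTranspositionSupplyAtTwo` HOLDS** (cell `bsd-f1-sign2`, lens `-an`, row AN-26S in the REPAIRED form C′ of REF1 §69:
`¬ IsSquare Δ`). For a globally minimal `W/ℚ` with `Δ > 0` not a square, `E(ℚ)[2] = 0`, rank `1`, `Ш[2] = 0` and `E(ℚ) ⊂ E⁰(ℝ)` there are an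
imaginary quadratic `K` and primes `q₀ ≠ q₁` with `(d_K, q₀, q₁)` two-transposition-admissible, `Sel₂(W^{(d_K)}) = 0`, `(d_K, N) = 1` and the
Heegner hypothesis. CONSTRUCTION (Mazur–Rubin 2010 Lemma 3.5 twice): `ρ̄_{W,2}` is onto (Dokchitser–Dokchitser), so some `g₀ ∈ Γ_ℚ` is ODD on
`{T₀,T₁,T₂}` (`Δ ∉ ℚ²`); `R = Sel^{rel ∞}_2(W) = {0, x, y, x + y}` with `x = κ(P₀) ≠ 0` (rank one; `#R = 4` at `ε = −1`). Twisting prime `q₀ > 8N`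
for `x` with Frobenius `F₀ ≡ g₀` on `E[2]` (§38): door OPEN at `q₀`, `(Δ/q₀) = −1`. Twisting prime `q₁ > q₀` with Frobenius `≡ c₀F₀` (`c₀` fixes
`E[2]` at `Δ > 0`, inverts `μ_{8N}`) for the class `y` if `loc_{q₀} y = 0`, else for `x + y`: `(Δ/q₁) = −1`, `8N ∣ q₀ + q₁`. Then `d = −q₀q₁ ≡ q₀²`
modulo `8N`: `d ≡ 1 (8)`, `(d/ℓ) = 1` at every `ℓ ∣ N` (Heegner, `2` split), `(d, N) = 1`, squarefree, the only primes of `d` are the two good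
transposition primes; and no non-zero class of `R` dies at both `q₀` and `q₁`, so `Sel₂(W^{(d)}) = 0` by the quadratic `iff` of T-2q
(`twoTranspositionTwistLaw_iff_strict_relaxedAtInfinity`, p669774). `K = ℚ(√d)` (`Quadratic.exists_numberField_discr_eq`). Known in print
(Mazur–Rubin 2010 §3 + Čebotarev); kernel-new; BSD is not proved by this. [cite: MazurRubin2010, Lemma 3.5, Lemma 3.2, Prop 3.3 (method)]
[cite: KlagsbrunMazurRubin2014, Prop. 47 (ii)] [cite: GrossLMS1991, §1 (p. 235)] -/
theorem twoTranspositionSupplyAtTwo_holds : TwoTranspositionSupplyAtTwo := by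
  intro W _ _ _ hΔ hnsq hT hrank hSha hegg
  classical
  haveI : Fact (Nat.Prime 2) := ⟨Nat.prime_two⟩
  haveI : PerfectField ℚ := PerfectField.ofCharZero
  have hNpos : 0 < W.conductorNorm ℤ := W.conductorNorm_pos_holds
  -- ### `ρ̄_{W,2}` onto; an ODD element `g₀`
  have hsurj : W.HasSurjectiveModNGaloisRep 2 := by
    refine (hasSurjectiveModNGaloisRep_two_iff W).mpr ⟨fun P hP ↦ ?_, hnsq⟩
    have h := eq_zero_of_two_smul_eq_zero W hT P
    convert h (by convert hP)
  have h2Q : (2 : ℚ) ≠ 0 := two_ne_zero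
  obtain ⟨g₀, hg₀δ⟩ : ∃ τ : absoluteGaloisGroup ℚ, τ • delta W h2Q ≠ delta W h2Q := by
    have h := mt (isSquare_Δ_iff_forall_smul_delta W h2Q).mpr hnsq
    push Not at h
    exact h
  have hg₀sign : Equiv.Perm.sign (permGal W h2Q g₀) = -1 := by
    rcases Int.units_eq_one_or (Equiv.Perm.sign (permGal W h2Q g₀)) with h | h
    · exact absurd (by rw [smul_delta, h, Units.val_one, Int.cast_one, one_mul]) hg₀δ
    · exact h
  have hinv : ∀ p : Equiv.Perm (Fin 3), Equiv.Perm.sign p = -1 → p * p = 1 := by decide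
  have hmov : ∀ p : Equiv.Perm (Fin 3), Equiv.Perm.sign p = -1 → ∃ i, p i ≠ i := by decide
  have hg₀v : ∃ P : geomTorsion W (2 : ℤ), g₀ • P ≠ P := by
    obtain ⟨i, hi⟩ := hmov _ hg₀sign
    exact ⟨T W h2Q i, fun h ↦ hi (T_injective W h2Q (by rw [T_permGal, h]))⟩
  have hfixT : ∀ σ : absoluteGaloisGroup ℚ, permGal W h2Q σ = 1 → σ ∈ torsionFixing W (2 : ℤ) := fun σ hσ ↦ by
    rw [mem_torsionFixing_iff]
    intro P
    rcases eq_zero_or_eq_T W h2Q P with rfl | ⟨i, rfl⟩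
    · exact smul_zero σ
    · rw [← T_permGal, hσ, Equiv.Perm.one_apply]
  have hg₀2 : g₀ * g₀ ∈ torsionFixing W (2 : ℤ) := hfixT _ (by rw [permGal_mul, hinv _ hg₀sign])
  -- ### complex conjugation (trivial on `E[2]` at `Δ > 0`) and a primitive `8N`-th root of unity
  obtain ⟨c₀, hc₀⟩ := exists_isComplexConjugation (Rat.castHom ℝ)
  have hc₀E : ∀ P : geomTorsion W (2 : ℤ), c₀ • P = P := GenusKolySign.twoTorsion_smul_eq_of_Δ_pos W hΔ hc₀
  obtain ⟨m, hmdef⟩ : ∃ m : ℕ, m = 8 * W.conductorNorm ℤ := ⟨_, rfl⟩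
  have hm : m ≠ 0 := by omega
  haveI : NeZero m := ⟨hm⟩
  have hm0 : ((m : ℕ) : AlgebraicClosure ℚ) ≠ 0 := by exact_mod_cast hm
  haveI : NeZero ((m : ℕ) : AlgebraicClosure ℚ) := ⟨hm0⟩
  obtain ⟨ζ, hζ⟩ := IsAlgClosed.exists_root (Polynomial.cyclotomic m (AlgebraicClosure ℚ))
    (Polynomial.degree_cyclotomic_pos m _ (Nat.pos_of_ne_zero hm)).ne'
  have hprim : IsPrimitiveRoot ζ m := Polynomial.isRoot_cyclotomic_iff.mp hζ
  have hζ0 : ζ ≠ 0 := hprim.ne_zero hm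
  -- ### the classes: `x = κ(P₀) ≠ 0`, `R = {0, x, y, x + y}`
  obtain ⟨P₀, hP₀⟩ := exists_kummerMapTorsion_ne_zero_of_rank_one W (hdiv_two W) hrank
  obtain ⟨x, hxdef⟩ : ∃ x : W.galH1Torsion ((2 : ℕ) : ℤ), x = kummerMapTorsion W ((2 : ℕ) : ℤ) (hdiv_two W) P₀ := ⟨_, rfl⟩
  have hx0 : x ≠ 0 := hxdef ▸ hP₀
  have hxR : x ∈ selmerGroupRelaxedAtInfinityAtTwo W := by
    rw [hxdef]
    exact (mem_selmerGroupRelaxedAtInfinityAtTwo_iff W _).mpr fun v ↦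
      kummerMapTorsion_mem_selmerLocalKer W ((2 : ℕ) : ℤ) (hdiv_two W) (v.adicCompletion ℚ) P₀
  have hR4 := natCard_selmerGroupRelaxedAtInfinityAtTwo_eq_four_of_not_meetsEgg W hΔ hT hrank hSha hegg
  have h2x : ∀ c : W.galH1Torsion ((2 : ℕ) : ℤ), c + c = 0 := fun c ↦ by
    rw [← two_nsmul]
    exact nsmul_galH1Torsion_natCast_eq_zero W 2 c
  haveI hRfin : Finite (selmerGroupRelaxedAtInfinityAtTwo W) := Nat.finite_of_card_ne_zero (by rw [hR4]; norm_num)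
  obtain ⟨y, hyR, hy0, hyx⟩ : ∃ y ∈ selmerGroupRelaxedAtInfinityAtTwo W, y ≠ 0 ∧ y ≠ x := by
    by_contra hne
    push Not at hne
    have hinj : Function.Injective
        (fun c : selmerGroupRelaxedAtInfinityAtTwo W ↦ decide ((c : W.galH1Torsion ((2 : ℕ) : ℤ)) = 0)) := by
      intro c c' h
      have h' : ((c : W.galH1Torsion ((2 : ℕ) : ℤ)) = 0 ↔ (c' : W.galH1Torsion ((2 : ℕ) : ℤ)) = 0) := by simpa using h
      apply Subtype.ext
      by_cases hc : (c : W.galH1Torsion ((2 : ℕ) : ℤ)) = 0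
      · rw [hc, h'.mp hc]
      · rw [hne c c.2 hc, hne c' c'.2 (fun h0 ↦ hc (h'.mpr h0))]
    have hle := Nat.card_le_card_of_injective _ hinj
    have h2 : Nat.card Bool = 2 := by simp
    rw [hR4, h2] at hle
    omega
  have hxy0 : x + y ≠ 0 := fun h ↦ hyx ((neg_eq_of_add_eq_zero_right h).symm.trans (neg_eq_of_add_eq_zero_right (h2x x)))
  have hxyR : x + y ∈ selmerGroupRelaxedAtInfinityAtTwo W := add_mem hxR hyR
  have henum : ∀ c ∈ selmerGroupRelaxedAtInfinityAtTwo W, c = 0 ∨ c = x ∨ c = y ∨ c = x + y := by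
    intro c hc
    by_contra hnot
    push Not at hnot
    obtain ⟨hc0, hcx, hcy, hcxy⟩ := hnot
    have hx_xy : x ≠ x + y := fun h ↦ hy0 (left_eq_add.mp h)
    have hy_xy : y ≠ x + y := fun h ↦ hx0 (by rw [add_comm] at h; exact left_eq_add.mp h)
    have hm1 : c ∉ ({0, x, y, x + y} : Finset (W.galH1Torsion ((2 : ℕ) : ℤ))) := by
      simp only [Finset.mem_insert, Finset.mem_singleton, not_or]; exact ⟨hc0, hcx, hcy, hcxy⟩
    have hm2 : (0 : W.galH1Torsion ((2 : ℕ) : ℤ)) ∉ ({x, y, x + y} : Finset (W.galH1Torsion ((2 : ℕ) : ℤ))) := by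
      simp only [Finset.mem_insert, Finset.mem_singleton, not_or]; exact ⟨fun h ↦ hx0 h.symm, fun h ↦ hy0 h.symm, fun h ↦ hxy0 h.symm⟩
    have hm3 : x ∉ ({y, x + y} : Finset (W.galH1Torsion ((2 : ℕ) : ℤ))) := by
      simp only [Finset.mem_insert, Finset.mem_singleton, not_or]; exact ⟨hyx.symm, hx_xy⟩
    have hm4 : y ∉ ({x + y} : Finset (W.galH1Torsion ((2 : ℕ) : ℤ))) := by
      simp only [Finset.mem_singleton]; exact hy_xy
    obtain ⟨S, hS⟩ : ∃ S : Finset (W.galH1Torsion ((2 : ℕ) : ℤ)), S = {c, 0, x, y, x + y} := ⟨_, rfl⟩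
    have hScard : S.card = 5 := by
      rw [hS, Finset.card_insert_of_notMem hm1, Finset.card_insert_of_notMem hm2, Finset.card_insert_of_notMem hm3,
        Finset.card_insert_of_notMem hm4, Finset.card_singleton]
    have hsub : ((S : Set (W.galH1Torsion ((2 : ℕ) : ℤ)))) ⊆ (selmerGroupRelaxedAtInfinityAtTwo W : Set _) := by
      intro z hz
      simp only [hS, Finset.coe_insert, Finset.coe_singleton, Set.mem_insert_iff, Set.mem_singleton_iff] at hz
      rcases hz with rfl | rfl | rfl | rfl | rfl
      · exact hc
      · exact zero_mem _
      · exact hxR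
      · exact hyR
      · exact hxyR
    have hfin : (selmerGroupRelaxedAtInfinityAtTwo W : Set (W.galH1Torsion ((2 : ℕ) : ℤ))).Finite := Set.toFinite _
    have hle := Set.ncard_le_ncard hsub hfin
    rw [Set.ncard_coe_finset, hScard] at hle
    have h4 : (selmerGroupRelaxedAtInfinityAtTwo W : Set (W.galH1Torsion ((2 : ℕ) : ℤ))).ncard = 4 := by
      rw [← hR4]; exact (Nat.card_coe_set_eq _).symm
    omega
  -- ### the first transposition prime `q₀ > 8N`, twisting for `x`
  obtain ⟨q₀, hq₀F, hbq₀, hq₀m, ⟨v₀, 𝔓₀, F₀, hv₀, h𝔓₀, hF₀, hF₀E, -, hF₀ζ⟩, hxloc⟩ :=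
    exists_twistingPrime_of_involution W hsurj hg₀2 hg₀v (x := x) hx0 hm hprim m
  have hq₀ : q₀.Prime := hq₀F.out
  have hq₀N : ¬ q₀ ∣ W.conductorNorm ℤ := fun h ↦ hq₀m (hmdef ▸ Dvd.dvd.mul_left h 8)
  have hq₀2 : q₀ ≠ 2 := by omega
  have hgood₀ : W.HasGoodReductionAtPrime q₀ := by
    by_contra hng
    exact hq₀N ((W.dvd_conductorNorm_iff_not_hasGoodReductionAtPrime q₀).mpr hng)
  have hx₀ : galoisCohomology.localization (W.torsionGaloisModule ((2 : ℕ) : ℤ)) (Sum.inr v₀) 1 x ≠ 0 :=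
    localization_ne_zero_of_not_mem_torsionLocalKer_padic W hv₀ hxloc
  have hjac₀ : jacobiSym W.Δ.num q₀ = -1 := jacobiSym_eq_neg_one_of_frob_smul_eq W hq₀2 hgood₀ hv₀ h𝔓₀ hF₀ hF₀E hg₀sign
  -- ### the second involution `g₁ = c₀ F₀`
  have hg₁2 : c₀ * F₀ * (c₀ * F₀) ∈ torsionFixing W (2 : ℤ) := by
    rw [mem_torsionFixing_iff]
    intro P
    rw [mul_smul, mul_smul, mul_smul, hF₀E, hc₀E, hF₀E, hc₀E, ← mul_smul]
    exact smul_eq_of_mem_torsionFixing W _ hg₀2 P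
  have hg₁v : ∃ P : geomTorsion W (2 : ℤ), (c₀ * F₀) • P ≠ P := by
    obtain ⟨P, hP⟩ := hg₀v
    exact ⟨P, by rwa [mul_smul, hF₀E, hc₀E]⟩
  have hg₁E : ∀ P : geomTorsion W (2 : ℤ), (c₀ * F₀) • P = g₀ • P := fun P ↦ by rw [mul_smul, hF₀E, hc₀E]
  have hg₁sign : Equiv.Perm.sign (permGal W h2Q (c₀ * F₀)) = -1 := by
    have hperm : permGal W h2Q (c₀ * F₀) = permGal W h2Q g₀ :=
      Equiv.ext fun i ↦ T_injective W _ (by rw [T_permGal, T_permGal, hg₁E])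
    rw [hperm, hg₀sign]
  have hg₁ζ : (c₀ * F₀) • ζ = (ζ ^ q₀)⁻¹ := by
    rw [mul_smul, hF₀ζ, smul_pow', RatClosure.smul_eq_inv_of_pow_eq_one hc₀ hm hprim.pow_eq_one, inv_pow]
  -- ### the second transposition prime `q₁ > q₀`, twisting for `y` or for `x + y`
  obtain ⟨q₁, hq₁F, v₁, 𝔓₁, F₁, hbq₁, hq₁m, hv₁, h𝔓₁, hF₁, hF₁E, hF₁ζ, hF₁ℓ, hyv, hxyv⟩ :
      ∃ (q₁ : ℕ) (_ : Fact q₁.Prime) (v₁ : HeightOneSpectrum (𝓞 ℚ)) (𝔓₁ : Ideal (absIntegers (𝓞 ℚ) ℚ))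
        (F₁ : absoluteGaloisGroup ℚ), q₀ < q₁ ∧ ¬ q₁ ∣ m ∧ (q₁ : 𝓞 ℚ) ∈ v₁.asIdeal ∧ 𝔓₁ ∈ v₁.primesAbove ∧
        IsArithFrobAt (𝓞 ℚ) F₁ 𝔓₁ ∧ (∀ P : geomTorsion W (2 : ℤ), F₁ • P = (c₀ * F₀) • P) ∧ F₁ • ζ = (c₀ * F₀) • ζ ∧ F₁ • ζ = ζ ^ q₁ ∧
        (galoisCohomology.localization (W.torsionGaloisModule ((2 : ℕ) : ℤ)) (Sum.inr v₀) 1 y ≠ 0 ∨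
          galoisCohomology.localization (W.torsionGaloisModule ((2 : ℕ) : ℤ)) (Sum.inr v₁) 1 y ≠ 0) ∧
        (galoisCohomology.localization (W.torsionGaloisModule ((2 : ℕ) : ℤ)) (Sum.inr v₀) 1 (x + y) ≠ 0 ∨
          galoisCohomology.localization (W.torsionGaloisModule ((2 : ℕ) : ℤ)) (Sum.inr v₁) 1 (x + y) ≠ 0) := by
    by_cases hy₀ : galoisCohomology.localization (W.torsionGaloisModule ((2 : ℕ) : ℤ)) (Sum.inr v₀) 1 y = 0
    · obtain ⟨q₁, hq₁F, hbq₁, hq₁m, ⟨v₁, 𝔓₁, F₁, hv₁, h𝔓₁, hF₁, hF₁E, hF₁ζ, hF₁ℓ⟩, hloc⟩ :=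
        exists_twistingPrime_of_involution W hsurj hg₁2 hg₁v (x := y) hy0 hm hprim q₀
      haveI := hq₁F
      refine ⟨q₁, hq₁F, v₁, 𝔓₁, F₁, hbq₁, hq₁m, hv₁, h𝔓₁, hF₁, hF₁E, hF₁ζ, hF₁ℓ,
        Or.inr (localization_ne_zero_of_not_mem_torsionLocalKer_padic W hv₁ hloc), Or.inl ?_⟩
      intro h
      apply hx₀
      have hadd := map_add (galoisCohomology.localization (W.torsionGaloisModule ((2 : ℕ) : ℤ)) (Sum.inr v₀) 1) x y
      calc _ = galoisCohomology.localization (W.torsionGaloisModule ((2 : ℕ) : ℤ)) (Sum.inr v₀) 1 x +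
            galoisCohomology.localization (W.torsionGaloisModule ((2 : ℕ) : ℤ)) (Sum.inr v₀) 1 y := by rw [hy₀, add_zero]
        _ = _ := hadd.symm
        _ = 0 := h
    · obtain ⟨q₁, hq₁F, hbq₁, hq₁m, ⟨v₁, 𝔓₁, F₁, hv₁, h𝔓₁, hF₁, hF₁E, hF₁ζ, hF₁ℓ⟩, hloc⟩ :=
        exists_twistingPrime_of_involution W hsurj hg₁2 hg₁v (x := x + y) hxy0 hm hprim q₀
      haveI := hq₁F
      exact ⟨q₁, hq₁F, v₁, 𝔓₁, F₁, hbq₁, hq₁m, hv₁, h𝔓₁, hF₁, hF₁E, hF₁ζ, hF₁ℓ, Or.inl hy₀,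
        Or.inr (localization_ne_zero_of_not_mem_torsionLocalKer_padic W hv₁ hloc)⟩
  haveI := hq₀F
  haveI := hq₁F
  have hq₁ : q₁.Prime := hq₁F.out
  have hq₁N : ¬ q₁ ∣ W.conductorNorm ℤ := fun h ↦ hq₁m (hmdef ▸ Dvd.dvd.mul_left h 8)
  have hq₁2 : q₁ ≠ 2 := by omega
  have hne : q₀ ≠ q₁ := by omega
  have hgood₁ : W.HasGoodReductionAtPrime q₁ := by
    by_contra hng
    exact hq₁N ((W.dvd_conductorNorm_iff_not_hasGoodReductionAtPrime q₁).mpr hng)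
  have hjac₁ : jacobiSym W.Δ.num q₁ = -1 :=
    jacobiSym_eq_neg_one_of_frob_smul_eq W hq₁2 hgood₁ hv₁ h𝔓₁ hF₁ (fun P ↦ (hF₁E P).trans (hg₁E P)) hg₀sign
  -- ### `8N ∣ q₀ + q₁`
  have hsum : m ∣ q₀ + q₁ := by
    rw [← hprim.pow_eq_one_iff_dvd]
    have h1 : ζ ^ q₁ = (ζ ^ q₀)⁻¹ := by rw [← hF₁ℓ, hF₁ζ, hg₁ζ]
    rw [pow_add, h1, mul_inv_cancel₀ (pow_ne_zero _ hζ0)]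
  -- ### the discriminant `d = −q₀q₁`
  obtain ⟨d, hddef⟩ : ∃ d : ℤ, d = -((q₀ : ℤ) * q₁) := ⟨_, rfl⟩
  have hdneg : d < 0 := by
    have : (0 : ℤ) < (q₀ : ℤ) * q₁ := mul_pos (Int.natCast_pos.mpr hq₀.pos) (Int.natCast_pos.mpr hq₁.pos)
    omega
  have hq₀d : (q₀ : ℤ) ∣ d := hddef ▸ dvd_neg.mpr (dvd_mul_right _ _)
  have hq₁d : (q₁ : ℤ) ∣ d := hddef ▸ dvd_neg.mpr (dvd_mul_left _ _)
  have hsumZ : (m : ℤ) ∣ (q₀ : ℤ) + q₁ := by exact_mod_cast hsum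
  have hdq : d = (q₀ : ℤ) ^ 2 - q₀ * (q₀ + q₁) := by rw [hddef]; ring
  have hdmod : ∀ n : ℤ, n ∣ (m : ℤ) → d % n = (q₀ : ℤ) ^ 2 % n := fun n hn ↦ by
    obtain ⟨s, hs⟩ := hn.trans hsumZ
    rw [hdq, hs, show (q₀ : ℤ) ^ 2 - q₀ * (n * s) = q₀ ^ 2 + n * (-(q₀ * s)) by ring, Int.add_mul_emod_self_left]
  have hq₀odd : Odd (q₀ : ℤ) := by exact_mod_cast hq₀.odd_of_ne_two hq₀2
  have hd8 : d % 8 = 1 := by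
    rw [hdmod 8 ⟨W.conductorNorm ℤ, by rw [hmdef]; push_cast; ring⟩, sq_emod_eight_of_odd hq₀odd]
  have hsf : Squarefree d := by
    rw [← Int.squarefree_natAbs, hddef, Int.natAbs_neg, Int.natAbs_mul, Int.natAbs_natCast, Int.natAbs_natCast,
      Nat.squarefree_mul ((Nat.coprime_primes hq₀ hq₁).mpr hne)]
    exact ⟨hq₀.squarefree, hq₁.squarefree⟩
  have hjacN : ∀ ℓ : ℕ, ℓ.Prime → ℓ ≠ 2 → ℓ ∣ W.conductorNorm ℤ → jacobiSym d ℓ = 1 := fun ℓ hℓ hℓ2 hℓN ↦ by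
    have hℓq₀ : ℓ ≠ q₀ := fun h ↦ hq₀N (h ▸ hℓN)
    rw [jacobiSym.mod_left, hdmod ℓ (Int.natCast_dvd_natCast.mpr (hmdef ▸ Dvd.dvd.mul_left hℓN 8)), ← jacobiSym.mod_left]
    exact jacobiSym.sq_one' (by rw [Int.gcd_natCast_natCast]; exact (Nat.coprime_primes hq₀ hℓ).mpr hℓq₀.symm)
  -- ### the field `K = ℚ(√d)`
  have hD : (d % 4 = 1 ∧ Squarefree d ∧ d ≠ 1) ∨ (4 ∣ d ∧ (d / 4 % 4 = 2 ∨ d / 4 % 4 = 3) ∧ Squarefree (d / 4)) :=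
    Or.inl ⟨by omega, hsf, by omega⟩
  obtain ⟨K, _, _, h2K, hdisc⟩ := Quadratic.exists_numberField_discr_eq hD
  have hK : IsImaginaryQuadratic K := ⟨h2K, Quadratic.isTotallyComplex_of_discr_neg h2K (by rw [hdisc]; exact hdneg)⟩
  have hH : SatisfiesHeegnerHypothesis (W.conductorNorm ℤ) K := by
    intro p hp hpN
    by_cases hp2 : p = 2
    · subst hp2
      have h := (Quadratic.ncard_primesOver_two_eq_two_iff h2K).mpr (by rw [hdisc]; exact hd8)
      exact_mod_cast h
    · exact (Quadratic.ncard_primesOver_eq_two_iff_jacobiSym h2K hp hp2).mpr (by rw [hdisc]; exact hjacN p hp hp2 hpN)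
  have hcop : Nat.Coprime (discr K).natAbs (W.conductorNorm ℤ) := by
    rw [hdisc, hddef, Int.natAbs_neg, Int.natAbs_mul, Int.natAbs_natCast, Int.natAbs_natCast]
    exact Nat.Coprime.mul_left ((Nat.Prime.coprime_iff_not_dvd hq₀).mpr hq₀N) ((Nat.Prime.coprime_iff_not_dvd hq₁).mpr hq₁N)
  -- ### two-transposition admissibility of `(d, q₀, q₁)`
  have hadm : TwoTranspAdmissible W d q₀ q₁ := by
    refine ⟨hdneg, hsf, hd8, hq₀, hq₁, hne, hq₀d, hq₁d, hjac₀, hjac₁, fun q hq hqd ↦ ?_, fun ℓ hℓ hℓ2 hbad ↦ ?_⟩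
    · have hqq : q = q₀ ∨ q = q₁ := by
        rw [hddef, dvd_neg] at hqd
        have h' : q ∣ q₀ * q₁ := by exact_mod_cast hqd
        rcases (Nat.Prime.dvd_mul hq).mp h' with h | h
        · exact Or.inl ((Nat.prime_dvd_prime_iff_eq hq hq₀).mp h)
        · exact Or.inr ((Nat.prime_dvd_prime_iff_eq hq hq₁).mp h)
      rcases hqq with rfl | rfl
      · exact ⟨fun _ ↦ hgood₀, fun h _ ↦ absurd rfl h⟩
      · exact ⟨fun _ ↦ hgood₁, fun _ h ↦ absurd rfl h⟩
    · haveI := Fact.mk hℓ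
      exact hjacN ℓ hℓ hℓ2 ((W.dvd_conductorNorm_iff_not_hasGoodReductionAtPrime ℓ).mpr (hbad inferInstance))
  -- ### the door is open at `q₀`, and no non-zero class of `R` dies at both door primes
  have hq₀Δ : ¬ (q₀ : ℤ) ∣ minimalDiscriminantInt W := W.not_dvd_minimalDiscriminantInt_of_hasGoodReductionAtPrime' _ hgood₀
  have hdoor : MeetsNonNormAt W q₀ :=
    meetsNonNormAt_of_localization_kummerMapTorsion_ne_zero W v₀ hv₀ hq₀2 hq₀Δ P₀ (by rw [← hxdef]; exact hx₀)
  have hbot : selmerGroupRelaxedAtInfinityAtTwo W ⊓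
      (galoisCohomology.localization (W.torsionGaloisModule ((2 : ℕ) : ℤ)) (Sum.inr v₀) 1).ker ⊓
      (galoisCohomology.localization (W.torsionGaloisModule ((2 : ℕ) : ℤ)) (Sum.inr v₁) 1).ker = ⊥ := by
    refine (AddSubgroup.eq_bot_iff_forall _).mpr fun c hc ↦ ?_
    have hcR : c ∈ selmerGroupRelaxedAtInfinityAtTwo W := hc.1.1
    have hc₀ : galoisCohomology.localization (W.torsionGaloisModule ((2 : ℕ) : ℤ)) (Sum.inr v₀) 1 c = 0 := hc.1.2
    have hc₁ : galoisCohomology.localization (W.torsionGaloisModule ((2 : ℕ) : ℤ)) (Sum.inr v₁) 1 c = 0 := hc.2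
    rcases henum c hcR with rfl | rfl | rfl | rfl
    · rfl
    · exact absurd hc₀ hx₀
    · rcases hyv with h | h
      · exact absurd hc₀ h
      · exact absurd hc₁ h
    · rcases hxyv with h | h
      · exact absurd hc₀ h
      · exact absurd hc₁ h
  have hcard : twistSelmerTwoCard W d = 1 :=
    (twoTranspositionTwistLaw_iff_strict_relaxedAtInfinity W hΔ hT hrank hSha hegg d q₀ q₁ hadm v₀ v₁ hv₀ hv₁ (Or.inl hdoor)).mpr hbot
  refine ⟨K, inferInstance, inferInstance, q₀, q₁, hK, ?_, ?_, hcop, hH⟩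
  · rw [hdisc]; exact hadm
  · rw [hdisc]; exact hcard

end Summit.BirchSwinnertonDyer.BirchSwinnertonDyer.Theorems.GenusKolyTransp

end
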